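import Literature.NumberTheory.GaloisCohomology.Sakamoto2024KolyvaginRankOne
import HarnessLib

/-!
# Sakamoto 2024, Theorem 4.4 (2): the ideal `I_R(κ_d)` of a basis of `KS₁(T, 𝓕)` is the initial
# Fitting ideal of the dual Selmer group — the case `R = ℤ/3^m`, `K = ℚ`, unfolded to cardinalities
# (named fact; cell `b2b-bsdres`, team n1011, ROUTE-1 item R1-22; sibling of
# `Sakamoto2024KolyvaginRankOne.lean`, conclusion (1), whose TODO this file discharges)

Topic `NumberTheory/GaloisCohomology`.  ONE cite-tagged named fact (`def … : Prop`), WEAKER than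
print (special case of the coefficient ring and of the base field; statement unfolded for
`R = ℤ/3^m`), never stronger; no theorem, no other definition.  Honest framing of the cell
(verbatim): research routes; no claim beyond stated classes; a typed fact is weaker than print or
equal, never stronger; nothing is booked here.

## Source, verbatim

R. Sakamoto, *The theory of Kolyvagin systems for `p = 3`*, J. Théor. Nombres Bordeaux **36** (2024)
919–946, p. 926 (read 2026-08-21 from the publisher's PDF):

> **Definition 4.2.** Let `S` be a ring and `M` a finitely generated `S`-module. For any element
> `m ∈ M`, we define an ideal `I_S(m)` of `S` by `I_S(m) := {f(m) | f ∈ Hom_S(M, S)}`.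
> **Remark 4.3.** Let `S` be a ring and `M` a finitely generated `S`-module. When the ring `S` is a
> zero-dimensional Gorenstein local ring, for any element `m ∈ M`, the natural homomorphism
> `Hom_S(M, S) → Hom_S(Sm, S)` is surjective since `S` is an injective `S`-module. Hence in this
> case, the ideal `I_S(m)` is independent of what the module `M` the element `m` is in, namely, for
> any `R`-submodule `N ⊂ M` with `m ∈ N`, we have
> `I_S(m) = {f(m) | f ∈ Hom_S(M, S)} = {f(m) | f ∈ Hom_S(N, S)}`.
> **Theorem 4.4.** Suppose that • `T` satisfies the hypotheses (H.1), (H.2), (H.3), and (H.SD) in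
> Section 2, • `𝓕` is cartesian with `χ(𝓕) = 1` and residually coisotropic. Then the following
> claims are valid. (1) The `R`-module `KS₁(T, 𝓕)` is free of rank `1`. […] (2) For any
> square-free ideal `d ∈ 𝒩` and basis `(κ_e)_{e∈𝒩} ∈ KS₁(T, 𝓕)`, we have
> `I_R(κ_d) = Fitt⁰_R(H¹_{𝓕^*(d)}(K, T^∨(1))^∨)`.

(Setting of §2, p. 921 — "We also put `(−)^∨ := Hom(−, ℚ₃/ℤ₃)`", so `T^∨(1) = Hom(T, μ_{3^α})` at the
FULL level — and Definitions 3.2, 3.3, 3.5, 3.6, 3.8, 4.1 as quoted in `Sakamoto2024KolyvaginRankOne.lean`;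
§3.1, p. 922: "For each prime `𝔮` of `K`, we define `H¹_{𝓕^*}(K_𝔮, T^∨(1)) ⊂ H¹(K_𝔮, T^∨(1))` to be the
orthogonal complement of `H¹_𝓕(K_𝔮, T)` with respect to the local Tate pairing, and we get the dual
Selmer structure `𝓕^*` on `T^∨(1)`"; `𝓕^*(d)` is the `d`-modified dual structure; `(·)^∨` the Pontryagin
dual.  On p. 926 the publisher's text layer drops the asterisk of `𝓕^*(d)` in (2); the statement is
restated with it as Prop. 7.7, p. 936, which is the star-safe locator.)

## What is typed, and how it is weaker than print

Exactly the setting and the binders of `Sakamoto2024.kolyvaginSystems_freeRankOne_zmod_three_pow`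
(conclusion (1); `R = ℤ/3^m`, `K = ℚ`, generator-fixed comparison maps bound to the canonical ones
by `HasCanonicalComparison` — see that file's docstring, which is not repeated), with conclusion (2)
UNFOLDED for `R = ℤ/3^m` as follows.  For `x` in an `R`-module of exponent `3^m`, Remark 4.3 gives
`I_R(x) = {f(x) | f ∈ Hom_R(Rx, R)} = 3^{m−e} R` where `3^e` is the (additive) order of `x`
(`Rx ≅ ℤ/3^e`, `Hom_R(ℤ/3^e, ℤ/3^m) = 3^{m−e} R`); and for a finite `R`-module `N` of order `3^c`,
`Fitt⁰_R(N^∨) = Fitt⁰_ℤ(N^∨)·R = (#N)·R = 3^{min(c,m)} R` (the Pontryagin dual has the same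
elementary divisors).  The group `N = N_d = H¹_{𝓕(d)^*}(ℚ, T^∨(1))`, `T^∨(1) = Hom(T, μ_{3^m})`, is the
dual Selmer group for the local Tate pairings at the FULL level `3^m`: a second Poitou–Tate family
`inv' : LocalInvariants ℚ (3^m)` with the four properties of `poitouTate_selmerStructure_duality` is
a binder (the residual family `inv : LocalInvariants ℚ 3` of (1) pairs `T̄` with `T̄^∨(1)` only).
So (2) says `m − e = min(c, m)`, i.e.
**`ord(κ_d) · #H¹_{𝓕(d)^*}(ℚ, T^∨(1)) = 3^m` if `#H¹_{𝓕(d)^*} ∣ 3^m`, and `κ_d = 0` if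
`3^m ∣ #H¹_{𝓕(d)^*}`** — stated with `addOrderOf (κ_d)` and `Nat.card` of the dual Selmer group of
`𝓕(d)` relative to the Poitou–Tate family `inv` (`LocalInvariants.dualSelmerStructure`, as in (1)).
"Basis" of the free rank-one `ℤ/3^m`-module `KS₁` = generator: `AddSubgroup.zmultiples κ = ⊤`.
The `⊗ G_d` of print is trivialised by the fixed generators `η` (generator-fixed convention of Kim,
AJM 148 §2.2.2, as in (1)); `I_R(·)` is invariant under `R`-isomorphisms, so nothing is lost.
Not typed: general zero-dimensional Gorenstein `R`, general number field `K`
(TODO(general form), as in (1)); Mathlib has no Fitting ideals, whence the unfolding.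

## Use

Route ROUTE-1 §20 of the cell (sub-route (a′), item (I5)): at `d = 1` the identity reads
`I_R(κ₁) = Fitt⁰_R(H¹_{𝓕^*}(ℚ, T^∨(1))^∨)`, i.e. a primitive Kolyvagin system's bottom class has
order `3^m / #H¹_{𝓕^*}(ℚ, T^∨(1))` — the input of the assembly R1-23.

The dual Selmer group is typed as that of the dual structure `(𝓕(d))^*`
(`inv.dualSelmerStructure ρ (D.atLevel 𝓕 d)`), which is the printed `𝓕^*(d)` because the transverse
conditions are their own annihilators (Mazur–Rubin Lemma 1.2.4 / Rubin PCMI Prop. 1.9.5 (4),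
Ex. 2.1.2: `(𝓕^a_b(c))^* = (𝓕^*)^b_a(c)`); at `d = 1` the two coincide literally.

References: [Sakamoto2024] Def. 4.2, Rem. 4.3, Thm. 4.4 (p. 926), and p. 927 ("When the maximal
ideal `𝔪_R` of `R` is principal, the assertions in Theorem 4.4 is proved by Mazur, Rubin, and Howard
in [17, Corollary 4.5.2]"); B. Mazur, K. Rubin, *Kolyvagin systems*, Mem. AMS 799 (2004),
Cor. 4.5.2; [Kim2022StructureSelmer] §2.2.2 (generator-fixed convention); [Rubin2011] Ex. 2.1.2.
-/

noncomputable section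

open scoped Classical NumberField ContRepresentation
open Field NumberField IsDedekindDomain
open Literature.NumberTheory.GaloisRepresentations Literature.NumberTheory.GaloisRepresentations.DiscreteGaloisModule
  Literature.NumberTheory.GaloisCohomology

namespace Literature.NumberTheory.GaloisCohomology.Sakamoto2024

/-- **Sakamoto 2024, Thm. 4.4 (2), for `R = ℤ/3^m` and `K = ℚ`, unfolded to cardinalities.**  In the
setting of `kolyvaginSystems_freeRankOne_zmod_three_pow` (same binders, verbatim: `T` finite free
over `ℤ/3^m` with the residual pair `red`, `incl`; (H.1), (H.2) with `τ`, (H.3), (H.SD) with `θ`; a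
Poitou–Tate family `inv`; `𝓕` unramified outside `S ∋ ∞, 3, S_ram(T)`, cartesian, of core rank `1`,
residually coisotropic; the datum `D` with Sakamoto's primes, the cyclotomic transverse conditions
and the canonical comparison maps for the generators `η`): for every BASIS `κ` of the free rank-one
`ℤ/3^m`-module `KS₁(T, 𝓕)` (a generator: `ℤκ = KS₁`) and every level `d ∈ 𝒩`, writing
`N_d = H¹_{𝓕(d)^*}(ℚ, T^∨(1))` for the dual Selmer group of `𝓕(d)`:
if `#N_d ∣ 3^m` then `ord(κ_d) · #N_d = 3^m`, and if `3^m ∣ #N_d` then `κ_d = 0` — which is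
"`I_R(κ_d) = Fitt⁰_R(H¹_{𝓕^*(d)}(K, T^∨(1))^∨)`" for `R = ℤ/3^m` (`I_R(x) = 3^{m−e}R` for `x` of order
`3^e` by Rem. 4.3; `Fitt⁰_R(N^∨) = (#N)·R`).  Here `T^∨(1) = Hom(T, μ_{3^m})` (`ρ.tateDual (3^m)`) and
the dual Selmer structure is taken for a Poitou–Tate family `inv'` at the FULL level `3^m` (binders
`inv'.IsPerfect`, …; two perfect families differ place by place by units of `ℤ/3^m`, so the
annihilators — hence `N_d` — do not depend on the choice), NOT for the residual family `inv` of
(1), which only computes `χ`, `λ^*` and coisotropy on `T̄` (cell planner r1's typing note,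
ROUTE-1 §21).  Weaker than print: `R = ℤ/3^m`, `K = ℚ` only.
[cite: Sakamoto2024, Thm. 4.4 (2) (p. 926; = Prop. 7.7, p. 936) with Def. 4.2 and Rem. 4.3 (p. 926)]
[cite: Kim2022StructureSelmer, §2.2.2 (generator-fixed convention)] -/
def kolyvaginSystems_idealOfBasis_eq_fittingIdeal_zmod_three_pow : Prop :=
  ∀ (M : Type) [AddCommGroup M] [TopologicalSpace M] [DiscreteTopology M] [Finite M]
    (Mbar : Type) [AddCommGroup Mbar] [TopologicalSpace Mbar] [DiscreteTopology Mbar] [Finite Mbar]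
    (m : ℕ) [NeZero m] [Module (ZMod (3 ^ m)) M] [Module.Free (ZMod (3 ^ m)) M]
    [Module.Finite (ZMod (3 ^ m)) M]
    (ρ : DiscreteGaloisModule ℚ M) (ρbar : DiscreteGaloisModule ℚ Mbar)
    (red : ρ.toContRepresentation →ⁱL ρbar.toContRepresentation)
    (incl : ρbar.toContRepresentation →ⁱL ρ.toContRepresentation)
    (τ : absoluteGaloisGroup ℚ)
    (θ : ρbar.toContRepresentation →ⁱL (ρbar.tateDual 3).toContRepresentation)
    (inv : LocalInvariants ℚ 3)
    (S : Finset (Place ℚ)) (𝓕 : SelmerStructure ρ) (D : KolyvaginDatum ρ)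
    (η : (q : HeightOneSpectrum (𝓞 ℚ)) → (ZMod (Ideal.absNorm q.asIdeal))ˣ),
    -- the residual pair is `T ↠ T/3T`, `T/3T ↪ T` with `incl ∘ red = 3^{m-1}`
    Function.Surjective red →
    (∀ x : M, red x = 0 ↔ ∃ y : M, x = (3 : ℤ) • y) →
    (∀ x : M, incl (red x) = ((3 : ℤ) ^ (m - 1)) • x) →
    -- (H.1)
    (∀ H : AddSubgroup Mbar, (∀ (σ : absoluteGaloisGroup ℚ) (x : Mbar), x ∈ H → ρbar σ x ∈ H) →
      H = ⊥ ∨ H = ⊤) →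
    -- (H.2)
    τ ∈ rootsOfUnityFixer ℚ (3 ^ m) → Nonempty (cokerSubOne ρ τ ≃+ ZMod (3 ^ m)) →
    -- (H.3)
    (∀ f : contOneCocycles ρbar.toTopRep,
      (∀ u : absoluteGaloisGroup ℚ, ρ u = 1 → u ∈ rootsOfUnityFixer ℚ (3 ^ m) → f.1 u = 0) →
        oneCocycleClass ρbar.toTopRep f = 0) →
    -- (H.SD)
    Function.Bijective θ →
    -- the local duality family (Poitou–Tate)
    inv.IsPerfect → inv.SumLocalTermEqZero → inv.UnramifiedOrthogonal → inv.SelmerComplement →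
    -- `S(𝓕) = S ⊇ {∞, 3} ∪ S_ram(T)`, `H¹_ur` outside `S`
    (∀ w : InfinitePlace ℚ, (Sum.inl w : Place ℚ) ∈ S) →
    (∀ v : HeightOneSpectrum (𝓞 ℚ), (Sum.inr v : Place ℚ) ∉ S →
      ((3 : ℕ) : 𝓞 ℚ) ∉ v.asIdeal ∧ GaloisRep.IsUnramifiedAt v ρ) →
    𝓕.IsUnramifiedOutside S →
    -- the hypotheses of Thm. 4.4 on `𝓕`
    𝓕.IsCartesian red incl S →
    LocalInvariants.HasCoreRank inv (𝓕.induced red) 3 1 →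
    inv.IsResiduallyCoisotropic (𝓕.induced red) θ S →
    -- the Kolyvagin datum: Sakamoto's `𝒫`, the transverse conditions, THE comparison maps
    D.primes = frobeniusClassPrimes ρ {v | (Sum.inr v : Place ℚ) ∈ S} τ (3 ^ m) →
    D.transverse = cyclotomicTransverse ρ →
    D.HasCanonicalComparison (3 ^ m) η →
    -- a Poitou–Tate family at the FULL level `3^m` (local Tate pairings
    -- `H¹(ℚ_v, T) × H¹(ℚ_v, T^∨(1)) → ℤ/3^m`, `T^∨(1) = Hom(T, μ_{3^m}) = ρ.tateDual (3^m)`), for the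
    -- dual Selmer groups `H¹_{𝓕(d)^*}(ℚ, T^∨(1))` of conclusion (2); the residual family `inv` above
    -- only serves `χ`, `λ^*` and coisotropy on `T̄`, as in (1)
    ∀ inv' : LocalInvariants ℚ (3 ^ m),
      inv'.IsPerfect → inv'.SumLocalTermEqZero → inv'.UnramifiedOrthogonal → inv'.SelmerComplement →
    -- conclusion (2), unfolded for `R = ℤ/3^m`: for every basis `κ` of `KS₁(T, 𝓕)` and level `d`,
    -- with `N_d := H¹_{𝓕(d)^*}(ℚ, T^∨(1)) = (inv'.dualSelmerStructure ρ (D.atLevel 𝓕 d)).selmerGroup`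
    ∀ κ : D.kolyvaginSystems 𝓕, AddSubgroup.zmultiples κ = ⊤ →
      ∀ d : Finset (HeightOneSpectrum (𝓞 ℚ)), D.IsLevel d →
        (Nat.card (inv'.dualSelmerStructure ρ (D.atLevel 𝓕 d)).selmerGroup ∣ 3 ^ m →
          addOrderOf (κ.1 d) * Nat.card (inv'.dualSelmerStructure ρ (D.atLevel 𝓕 d)).selmerGroup =
            3 ^ m) ∧
        (3 ^ m ∣ Nat.card (inv'.dualSelmerStructure ρ (D.atLevel 𝓕 d)).selmerGroup → κ.1 d = 0)

end Literature.NumberTheory.GaloisCohomology.Sakamoto2024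

end
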